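import Summits.AtomisticToContinuum.HydrodynamicLimit.Theorems.OneFlightGossipEngineClampedTransferDockCubicChannelRate
import Summits.AtomisticToContinuum.HydrodynamicLimit.Theorems.OneFlightGossipEngineSuperExponentialEnergyTailsDefs
import Summits.AtomisticToContinuum.HydrodynamicLimit.Theorems.OneFlightGossipEngineSuperExponentialEnergyTailsDefsB
import Summits.AtomisticToContinuum.HydrodynamicLimit.Theorems.OneFlightGossipEngineSuperExponentialEnergyTailsSeetOfGevrey
import Summits.AtomisticToContinuum.HydrodynamicLimit.Theorems.OneFlightGossipEngineSuperExponentialEnergyTailsMomentRegularity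
import Summits.AtomisticToContinuum.HydrodynamicLimit.Theorems.OneFlightGossipEngineSuperExponentialEnergyTailsGevreyInduction
import Summits.AtomisticToContinuum.HydrodynamicLimit.Theorems.OneFlightGossipEngineSuperExponentialEnergyTailsHierarchyOfInputs
import HarnessLib

/-!
# Skeleton — line `Sketch` of crux `SuperExponentialEnergyTails` (stmt-AtomisticToContinuum-17701), v2

Lead prover-line-stmt-AtomisticToContinuum-17701-0 (2026-08-17).  Card `euler-gauged-bobylev-summation`
(IdeatorTwo sketch), RESHAPED TWICE.  STATUS v2.3: EVERY PROVABLE STUB LANDED (T1′, R, S, MI imported below); the skeleton is CLOSED MODULO the three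
true-law contact inputs SD, CE, F (the split: `…Theorems.SuperExponentialEnergyTailsSplit.SuperExponentialEnergyTails_of_contactInputs`).

* v1 (registered 06:2xZ): C⁺ := `k`-wise Gaussian-class hierarchy in Euler gauge; transfer stubs T1
  `stub_seetOfVelocityHierarchy`, T2 `stub_velocityOfGaugedHierarchy` (waved).
* v2 (this file): the gauge is DROPPED and the class is RELAXED to Gevrey `k^{3k/2}`.  Reason: SEET tolerates any
  moment class `C Aᵏ k^{βk}` with `β < 2` (order chosen after the level: `stub_seetOfGevreyHierarchy`), and in a
  Gevrey class `β > 1` the binomial weights `C(k,j)^{1−β}` absorb a one-sided chaos constant growing POLYNOMIALLY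
  in the lower order — which is exactly what spatial hot spots of the profiles cost for UNGAUGED moments (the
  9218 obstruction).  Ungauged speeds are constant on free flights, so the power ledger is EXACT (no drift, no
  truncation, no re-gauging), and the Bobylev/Desvillettes argument closes order by order by a maximum principle
  (no generating functions): `stub_gevreyInduction` (pure real analysis over `MomentSystem`).
* The `N`-side plumbing is `stub_momentRegularity` (finiteness, continuity in time, mass, energy, Lyapunov,
  Gaussian initial class, exact power ledger — all unconditional) and `stub_gevreyHierarchyOfInputs` (assembles
  the `MomentSystem` of the true-law moments from the ledger and the three contact inputs, handles the order
  truncation `n_N`, and applies the induction).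
* The line's residual content is the three TRUE-LAW contact inputs `stub_povznerCeiling`, `stub_chaosCeiling`,
  `stub_rateFloor` (order-uniform twins of the filed 9235 primitives SD / S2a″ / RF₂), held by the lead.

Composition: `SuperExponentialEnergyTails_of` concludes the crux BY NAME through the LANDED twin
`ClampedTransferDockCubicRate.SuperExponentialEnergyTails` of the route decl.  All propositions are the landed
support files `…SuperExponentialEnergyTailsDefs` (p144693) / `…DefsB`.
-/

noncomputable section

namespace Summit.AtomisticToContinuum.HydrodynamicLimit.Theorems.SuperExponentialEnergyTailsSketch

open scoped BigOperators ENNReal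
open MeasureTheory Set
open Literature.MathematicalPhysics.KineticTheory Literature.Analysis.FluidPDE
open Summit.AtomisticToContinuum.HydrodynamicLimit.Theorems.SuperExponentialEnergyTailsLine
  (VelocityMomentHierarchy GaugedMomentHierarchy VelocityMomentGevreyHierarchy PovznerCeiling ChaosCeiling
    RateFloor MomentRegularity GevreyInduction)
open Summit.AtomisticToContinuum.HydrodynamicLimit.Theorems.SuperExponentialEnergyTailsSeetOfGevrey
  (stub_seetOfGevreyHierarchy)
open Summit.AtomisticToContinuum.HydrodynamicLimit.Theorems.SuperExponentialEnergyTailsMomentRegularity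
  (stub_momentRegularity)
open Summit.AtomisticToContinuum.HydrodynamicLimit.Theorems.SuperExponentialEnergyTailsGevreyInduction
  (stub_gevreyInduction)
open Summit.AtomisticToContinuum.HydrodynamicLimit.Theorems.SuperExponentialEnergyTailsHierarchyOfInputs
  (stub_gevreyHierarchyOfInputs)

/-! ## Stubs — transfer -/

-- T1′ `stub_seetOfGevreyHierarchy` LANDED: `…Theorems.SuperExponentialEnergyTailsSeetOfGevrey.stub_seetOfGevreyHierarchy` (p146991).

/-! ## Stubs — the Gevrey moment scheme (provable plumbing) -/

-- R `stub_momentRegularity` LANDED: `…Theorems.SuperExponentialEnergyTailsMomentRegularity.stub_momentRegularity` (p147071;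
-- stages p146265 PowerLedger, p146274 MomentStatics, p146275 MomentContinuity).

-- S `stub_gevreyInduction` LANDED: `…Theorems.SuperExponentialEnergyTailsGevreyInduction.stub_gevreyInduction` (p147511;
-- stages p146809 Prelim, p146810 MaxPrinciple, p147220 GevreyGain).

-- MI `stub_gevreyHierarchyOfInputs` LANDED: `…Theorems.SuperExponentialEnergyTailsHierarchyOfInputs.stub_gevreyHierarchyOfInputs`
-- (p149096; stage p147074 InputsToReal).

/-! ## Stubs — the three true-law contact inputs (the line's residual content; conjecture-grade) -/

/-- **Stub SD — Povzner ceiling** (empirical impact law of the collisions under the true pre-shock law dominated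
by a constant times the flux-uniform one, uniformly in the order). [conjecture-grade; registered; held by the lead] -/
theorem stub_povznerCeiling : PovznerCeiling := by
  sorry

/-- **Stub CE — chaos ceiling** (one-sided molecular chaos at contact for the pair marks `‖v⁻‖^{2j}‖v_*⁻‖^{2l}`,
constant polynomial in `min j l`, true pre-shock law). [conjecture-grade; registered; held by the lead] -/
theorem stub_chaosCeiling : ChaosCeiling := by
  sorry

/-- **Stub F — rate floor** (energetic spheres are hit at rate `≳ ν_N ‖v‖` under the true pre-shock law, weight-
uniformly). [conjecture-grade; registered; held by the lead] -/
theorem stub_rateFloor : RateFloor := by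
  sorry

/-! ## Composition -/

/-- **The crux from the stubs**: `SuperExponentialEnergyTails` (route decl, by name) follows from the three
true-law contact inputs through the Gevrey moment scheme and the order-after-level transfer at `β = 3/2 < 2`. -/
theorem SuperExponentialEnergyTails_of :
    Summit.AtomisticToContinuum.HydrodynamicLimit.Theses.OneFlightGossipEngine.SuperExponentialEnergyTails :=
  -- the twin `ClampedTransferDockCubicRate.SuperExponentialEnergyTails` unfolds to the route decl's text
  stub_seetOfGevreyHierarchy ((3 : ℝ) / 2) (by norm_num) (by norm_num)
    (stub_gevreyHierarchyOfInputs stub_gevreyInduction stub_momentRegularity stub_povznerCeiling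
      stub_chaosCeiling stub_rateFloor)

end Summit.AtomisticToContinuum.HydrodynamicLimit.Theorems.SuperExponentialEnergyTailsSketch

end
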